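import Summits.QuantumFields.YangMills.Theorems.IR.AfPincerUcXCovFemto
import Summits.QuantumFields.YangMills.Theorems.BalabanLadderNTReferenceTorusTempered

/-!
# Crux `IR` (stmt-QuantumFields-19354), line `af-pincer`, X-side (lane (1)A): TEMPERED femto tools — a tempered sup bound, the
# tempered per-pair law of total covariance through one cube, and the far-pair numerics

Preparatory file for `Theorems/IR/AfPincerUcXCovFemtoTempered` (seat ym-19354-afpincer-s2, generation 3), sibling of
`Theorems/IR/AfPincerUcXCovFemto` (`covWindow_of_femtoAF`: the WINDOW from E1-osc ∧ CondCovAF for EVERY exterior).  The tempered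
version assumes the two cube-kernel hypotheses only ON a measurable GOOD set of exteriors and pays the complement by its mass under
Wilson's measure (the `NT` desk's hedge `Reference.abs_torusCov_sub_torusE_kerCov_le_on`, `Theorems/BalabanLadderNTReferenceTorusTempered`).

* §1 `abs_integral_le_of_abs_le_on` — `|∫ f dμ| ≤ V + M δ` when `|f| ≤ V` on `S`, `|f| ≤ M` everywhere, `μ(Sᶜ) ≤ δ`;
* §2 `femto_pair_bound_on` — `|Cov_{β,L}(A_x,A_y)| ≤ V + 2M²δ + (h_x + 2Mδ)(h_y + 2Mδ) + 4M²δ` through the cube of radius `R` around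
  `x` (oscillations `h_x, h_y` and covariance bound `V` ON GOOD, bad mass `δ`);
* §3 the three far-pair estimates of the window proof as stand-alone arithmetic lemmas (`femto_af_term_le`,
  `femto_boundary_term_le`, `femto_rarity_term_le`).

HONEST FRAMING.  Bookkeeping; nothing here is a statement about Yang–Mills beyond the exact DLR equation; one open gap-crux of a
CONDITIONAL chain (Track A 0/28 UV); not Clay.  No `sorry`; axioms ⊆ {propext, Classical.choice, Quot.sound}.
-/

set_option autoImplicit false

noncomputable section

open Filter Topology Finset MeasureTheory
open scoped BigOperators SchwartzMap
open Literature.MathematicalPhysics.QuantumFieldTheory hiding ZdEdge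
open Literature.MathematicalPhysics.QuantumLattice
open Literature.Probability.LatticeModels (Site box mem_box)
open Summit.QuantumFields.YangMills.Cruxes.OSLegsFromFemtoAndGap.DlrCollarTransfer
open Summit.QuantumFields.YangMills.Cruxes.IR.AfOnset

namespace Summit.QuantumFields.YangMills.Cruxes.IR.AfPincerUc

variable {G : Type} [Group G] [TopologicalSpace G] [IsTopologicalGroup G] [CompactSpace G]
  [MeasurableSpace G] [BorelSpace G]

/-! ## §1 A tempered sup bound for an integral -/
section Helper

omit [Group G] [TopologicalSpace G] [IsTopologicalGroup G] [CompactSpace G] [MeasurableSpace G] [BorelSpace G] in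
/-- **Tempered sup bound.**  On a probability space: a measurable `S` with `μ(Sᶜ) ≤ δ`, an integrable `f` with `|f| ≤ V` on `S`
(`V ≥ 0`) and `|f| ≤ M` everywhere (`M ≥ 0`) for a function `f`: `|∫ f dμ| ≤ V + M δ` (pointwise `|f| ≤ V + M·1_{Sᶜ}`; no
integrability needed, the Bochner integral of a non-integrable `f` being `0`). [folklore] -/
theorem abs_integral_le_of_abs_le_on {Ω : Type*} [MeasurableSpace Ω] {μ : Measure Ω} [IsProbabilityMeasure μ]
    {f : Ω → ℝ} {S : Set Ω} (hS : MeasurableSet S) {V M δ : ℝ} (hV0 : 0 ≤ V) (hM0 : 0 ≤ M)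
    (hV : ∀ ω ∈ S, |f ω| ≤ V) (hM : ∀ ω, |f ω| ≤ M) (hδ : μ.real Sᶜ ≤ δ) : |∫ ω, f ω ∂μ| ≤ V + M * δ := by
  have hpt : ∀ᵐ ω ∂μ, ‖f ω‖ ≤ V + M * Sᶜ.indicator (fun _ => (1 : ℝ)) ω :=
    ae_of_all _ fun ω => by
      rw [Real.norm_eq_abs]
      by_cases hω : ω ∈ S
      · have : Sᶜ.indicator (fun _ => (1 : ℝ)) ω = 0 := Set.indicator_of_notMem (by simpa using hω) _
        rw [this, mul_zero, add_zero]
        exact hV ω hω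
      · have : Sᶜ.indicator (fun _ => (1 : ℝ)) ω = 1 := Set.indicator_of_mem (by simpa using hω) _
        rw [this, mul_one]
        linarith [hM ω]
  have key := norm_integral_le_of_norm_le
    (Summit.QuantumFields.YangMills.Cruxes.NT.Reference.integrable_const_add_mul_indicator hS.compl V M) hpt
  rw [Summit.QuantumFields.YangMills.Cruxes.NT.Reference.integral_const_add_mul_indicator hS.compl] at key
  rw [← Real.norm_eq_abs]
  calc ‖∫ ω, f ω ∂μ‖ ≤ V + M * μ.real Sᶜ := key
    _ ≤ V + M * δ := by nlinarith [measureReal_nonneg (μ := μ) (s := Sᶜ)]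

end Helper

/-! ## §2 The tempered per-pair bound -/
section Pair

/-- **Tempered per-pair femto bound.**  On a torus of half-side `L ≥ R + 2`, sites `x, y` with `|y − x|_∞ + 1 ≤ R`, action densities
bounded by `M`, a measurable GOOD set of exteriors of the cube of radius `R` around `x` whose complement has mass `≤ δ ≥ 0` under Wilson's
measure read through the lift: if ON GOOD the cube-kernel means of `A_x`, `A_y` oscillate by at most `h_x, h_y ≥ 0` and the
cube-kernel covariance is at most `V ≥ 0` in absolute value, then
`|Cov_{β,L}(A_x, A_y)| ≤ V + 2M²δ + (h_x + 2Mδ)(h_y + 2Mδ) + 4M²δ`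
(`NT.Reference.abs_torusCov_sub_torusE_kerCov_le_on` + `abs_integral_le_of_abs_le_on` with `|kerCov| ≤ 2M²`). [folklore] -/
theorem femto_pair_bound_on (r : LatticeRep G) (β : ℝ) (x y : Fin 4 → ℤ) (R L : ℕ) (hRL : R + 2 ≤ L)
    (hR : 1 ≤ R) (hyx : ∀ j, |y j - x j| + 1 ≤ (R : ℤ)) {M : ℝ} (hM : ∀ (z : Fin 4 → ℤ) (U : LGConfig 4 G), |dens G r z U| ≤ M)
    {Good : Set (LGConfig 4 G)} (hGood : MeasurableSet Good) {hx hy V δ : ℝ} (hhx : 0 ≤ hx) (hhy : 0 ≤ hy)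
    (hV0 : 0 ≤ V)
    (hδ : (wilsonMeasure (d := 4) (L := 2 * L + 1) r.ρ β).real ((torusLift (2 * L + 1)) ⁻¹' Good)ᶜ ≤ δ)
    (hox : ∀ η ∈ Good, ∀ η' ∈ Good, |kerE G r β (fun j => x j - R) (2 * R + 1) η (dens G r x) -
      kerE G r β (fun j => x j - R) (2 * R + 1) η' (dens G r x)| ≤ hx)
    (hoy : ∀ η ∈ Good, ∀ η' ∈ Good, |kerE G r β (fun j => x j - R) (2 * R + 1) η (dens G r y) -
      kerE G r β (fun j => x j - R) (2 * R + 1) η' (dens G r y)| ≤ hy)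
    (hVG : ∀ η ∈ Good, |kerCov G r β (fun j => x j - R) (2 * R + 1) η (dens G r x) (dens G r y)| ≤ V) :
    |torusE G r β L (fun U => dens G r x U * dens G r y U) -
        torusE G r β L (dens G r x) * torusE G r β L (dens G r y)| ≤
      V + 2 * M ^ 2 * δ + ((hx + 2 * M * δ) * (hy + 2 * M * δ) + 4 * M * M * δ) := by
  haveI := r.secondCountableTopology
  haveI := isProbabilityMeasure_wilsonMeasure (d := 4) (L := 2 * L + 1) r.ρ r.continuous β
  have hM0 : 0 ≤ M := (abs_nonneg _).trans (hM x (fun _ => 1))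
  have hxx : ∀ j, |x j - x j| + 1 ≤ (R : ℤ) := fun j => by simp; exact_mod_cast hR
  have hL : 2 * R + 1 + 3 ≤ 2 * L + 1 := by omega
  have key := Summit.QuantumFields.YangMills.Cruxes.NT.Reference.abs_torusCov_sub_torusE_kerCov_le_on G r β
    (fun j => x j - R) (2 * R + 1) L hL (continuous_dens r x) (continuous_dens r y) (hM x) (hM y)
    (StubLower.isCylinder_dens G r x) (StubLower.isCylinder_dens G r y)
    (fun e he j => by
      have h := StubLower.dens_supp_window G r x x R hxx e he j
      push_cast
      constructor <;> linarith [h.1, h.2])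
    (fun e he j => by
      have h := StubLower.dens_supp_window G r x y R hyx e he j
      push_cast
      constructor <;> linarith [h.1, h.2])
    hGood hhx hhy hδ hox hoy
  -- the torus mean of the kernel covariances: `≤ V` on the good set, `≤ 2M²` everywhere
  have hall : ∀ U : GaugeConfig 4 (2 * L + 1) G,
      |kerCov G r β (fun j => x j - R) (2 * R + 1) (torusLift (2 * L + 1) U) (dens G r x) (dens G r y)| ≤ 2 * M * M :=
    fun U => Summit.QuantumFields.YangMills.Cruxes.NT.Reference.abs_kerCov_le G r β _ _ _ (hM x) (hM y)
  have hmean : |torusE G r β L (fun ζ => kerCov G r β (fun j => x j - R) (2 * R + 1) ζ (dens G r x) (dens G r y))|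
      ≤ V + 2 * M * M * δ := by
    unfold torusE
    exact abs_integral_le_of_abs_le_on ((continuous_torusLift (d := 4) (G := G) (2 * L + 1)).measurable hGood) hV0
      (by positivity) (fun U hU => hVG _ hU) hall hδ
  have tri := abs_sub_abs_le_abs_sub
    (torusE G r β L (fun U => dens G r x U * dens G r y U) - torusE G r β L (dens G r x) * torusE G r β L (dens G r y))
    (torusE G r β L (fun ζ => kerCov G r β (fun j => x j - R) (2 * R + 1) ζ (dens G r x) (dens G r y)))
  have e : 2 * M * M * δ = 2 * M ^ 2 * δ := by ring
  linarith

end Pair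

/-! ## §3 Numerics of the far pairs (isolated, so that each arithmetic step elaborates on its own budget) -/
section Numerics

omit [Group G] [TopologicalSpace G] [IsTopologicalGroup G] [CompactSpace G] [MeasurableSpace G] [BorelSpace G] in
/-- The AF term: `(W/(2⁸c))/E⁸ ≤ (W/c)/(1+t)⁸` for `1 ≤ t ≤ E` (`(1+t)⁸ ≤ (2E)⁸`). [arithmetic] -/
theorem femto_af_term_le {W c t E : ℝ} (hW : 0 ≤ W) (hc : 0 < c) (ht1 : 1 ≤ t) (htE : t ≤ E) :
    (W / (2 ^ 8 * c)) / E ^ 8 ≤ (W / c) / (1 + t) ^ 8 := by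
  have hE0 : 0 < E := lt_of_lt_of_le one_pos (ht1.trans htE)
  have hpos : 0 < (1 + t) ^ 8 := by positivity
  rw [div_le_div_iff₀ (by positivity) hpos]
  have h2t : 1 + t ≤ 2 * E := by linarith
  have h8 : (1 + t) ^ 8 ≤ (2 * E) ^ 8 := pow_le_pow_left₀ (by positivity) h2t 8
  calc W / (2 ^ 8 * c) * (1 + t) ^ 8 ≤ W / (2 ^ 8 * c) * (2 * E) ^ 8 :=
        mul_le_mul_of_nonneg_left h8 (by positivity)
    _ = W / c * E ^ 8 := by
        field_simp

omit [Group G] [TopologicalSpace G] [IsTopologicalGroup G] [CompactSpace G] [MeasurableSpace G] [BorelSpace G] in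
/-- The boundary term: with `εb ≤ 1`, `εb ≤ W/(c (C₁²+1))`, `2/(T′κ) ≤ εb`, `uβ ≤ 1/T′`, `t·uβ ≤ 1/T′`:
`C₁(uβ/κ)⁴ · C₁(uβ/κ)⁴ ≤ (W/c)/(1+t)⁸` (`(uβ(1+t)/κ)⁸ ≤ εb⁸ ≤ εb`). [arithmetic] -/
theorem femto_boundary_term_le {W c C₁ κ υ t T' εb : ℝ} (hc : 0 < c) (hκ : 0 < κ) (hυ : 0 < υ)
    (ht0 : 0 ≤ t) (hT'0 : 0 < T') (hεb0 : 0 < εb) (hεb1 : εb ≤ 1) (hεbW : εb ≤ W / (c * (C₁ ^ 2 + 1)))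
    (hq2 : 2 / (T' * κ) ≤ εb) (hu1 : υ ≤ 1 / T') (htu : t * υ ≤ 1 / T') :
    C₁ * (υ / κ) ^ 4 * (C₁ * (υ / κ) ^ 4) ≤ (W / c) / (1 + t) ^ 8 := by
  have hpos : 0 < (1 + t) ^ 8 := by positivity
  set q : ℝ := υ * (1 + t) / κ with hq
  have hq0 : 0 ≤ q := by positivity
  have hq1 : q ≤ εb := by
    refine le_trans ?_ hq2
    rw [hq, div_le_div_iff₀ hκ (by positivity)]
    have : υ * (1 + t) ≤ 2 / T' := by
      calc υ * (1 + t) = υ + t * υ := by ring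
        _ ≤ 1 / T' + 1 / T' := add_le_add hu1 htu
        _ = 2 / T' := by ring
    calc υ * (1 + t) * (T' * κ) = (υ * (1 + t)) * T' * κ := by ring
      _ ≤ (2 / T') * T' * κ := by gcongr
      _ = 2 * κ := by field_simp
  have hq8 : q ^ 8 ≤ εb := (pow_le_pow_left₀ hq0 hq1 8).trans (pow_le_of_le_one hεb0.le hεb1 (by norm_num))
  rw [le_div_iff₀ hpos]
  have e : C₁ * (υ / κ) ^ 4 * (C₁ * (υ / κ) ^ 4) * (1 + t) ^ 8 = C₁ ^ 2 * q ^ 8 := by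
    rw [hq]; ring
  rw [e]
  have hW0 : 0 ≤ W := by
    have h := hεb0.le.trans hεbW
    have hden : 0 < c * (C₁ ^ 2 + 1) := by positivity
    exact (div_nonneg_iff.1 h).elim (fun h => h.1) fun h => absurd h.2 (not_le.2 hden)
  have hC2 : C₁ ^ 2 * εb ≤ W / c := by
    have h := mul_le_mul_of_nonneg_left hεbW (sq_nonneg C₁)
    have e2 : C₁ ^ 2 * (W / (c * (C₁ ^ 2 + 1))) = (W / c) * (C₁ ^ 2 / (C₁ ^ 2 + 1)) := by
      field_simp
    have h3 : C₁ ^ 2 / (C₁ ^ 2 + 1) ≤ 1 := by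
      rw [div_le_one (by positivity)]; linarith
    calc C₁ ^ 2 * εb ≤ C₁ ^ 2 * (W / (c * (C₁ ^ 2 + 1))) := h
      _ = (W / c) * (C₁ ^ 2 / (C₁ ^ 2 + 1)) := e2
      _ ≤ (W / c) * 1 := mul_le_mul_of_nonneg_left h3 (by positivity)
      _ = W / c := mul_one _
  exact (mul_le_mul_of_nonneg_left hq8 (sq_nonneg C₁)).trans hC2

omit [Group G] [TopologicalSpace G] [IsTopologicalGroup G] [CompactSpace G] [MeasurableSpace G] [BorelSpace G] in
/-- The rarity terms: with `K = 4MC₁ + 10M² + 1`, `0 ≤ δ ≤ min 1 (D uβ⁸)`, `D ≤ W T′⁸/(2¹⁰ K)`, `hb ≤ C₁`, `1 ≤ t ≤ 1/(T′uβ)`: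
`2M²δ + ((hb + 2Mδ)² + 4M²δ) ≤ hb² + (W/4)/(1+t)⁸`. [arithmetic] -/
theorem femto_rarity_term_le {W M C₁ hb δ D υ t T' : ℝ} (hM0 : 0 ≤ M) (hC₁ : 0 ≤ C₁)
    (hhbC : hb ≤ C₁) (hδ0 : 0 ≤ δ) (hδ1 : δ ≤ 1) (hD0 : 0 ≤ D) (hδD : δ ≤ D * υ ^ 8)
    (hDW : D ≤ W * T' ^ 8 / (2 ^ 10 * (4 * M * C₁ + 10 * M ^ 2 + 1))) (hυ : 0 < υ) (hT'0 : 0 < T') (ht1 : 1 ≤ t)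
    (htT : t ≤ 1 / (T' * υ)) :
    2 * M ^ 2 * δ + ((hb + 2 * M * δ) * (hb + 2 * M * δ) + 4 * M * M * δ) ≤ hb * hb + (W / 4) / (1 + t) ^ 8 := by
  have ht0 : 0 ≤ t := zero_le_one.trans ht1
  have hpos : 0 < (1 + t) ^ 8 := by positivity
  set K : ℝ := 4 * M * C₁ + 10 * M ^ 2 + 1 with hK
  have hK0 : 0 < K := by positivity
  -- the `δ`-terms are at most `K δ`
  have h1 : 4 * M * δ * hb ≤ 4 * M * δ * C₁ := mul_le_mul_of_nonneg_left hhbC (by positivity)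
  have h2 : δ ^ 2 ≤ δ := pow_le_of_le_one hδ0 hδ1 two_ne_zero
  have h3 : 4 * M ^ 2 * δ ^ 2 ≤ 4 * M ^ 2 * δ := mul_le_mul_of_nonneg_left h2 (by positivity)
  have hlin : 2 * M ^ 2 * δ + ((hb + 2 * M * δ) * (hb + 2 * M * δ) + 4 * M * M * δ) ≤ hb * hb + K * δ := by
    have e : (hb + 2 * M * δ) * (hb + 2 * M * δ) = hb * hb + 4 * M * δ * hb + 4 * M ^ 2 * δ ^ 2 := by ring
    rw [e, hK]
    nlinarith [h1, h3, hδ0, hM0, hC₁]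
  -- `K δ ≤ (W/4)/(1+t)⁸`
  have hKδ : K * δ ≤ (W / 4) / (1 + t) ^ 8 := by
    have h1t : 1 + t ≤ 2 / (T' * υ) := by
      have : (1 : ℝ) ≤ 1 / (T' * υ) := le_trans ht1 htT
      calc 1 + t ≤ 1 / (T' * υ) + 1 / (T' * υ) := add_le_add this htT
        _ = 2 / (T' * υ) := by ring
    have h8 : (1 + t) ^ 8 ≤ (2 / (T' * υ)) ^ 8 := pow_le_pow_left₀ (by positivity) h1t 8
    have hpow : υ ^ 8 * (2 / (T' * υ)) ^ 8 = 2 ^ 8 / T' ^ 8 := by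
      field_simp
    rw [le_div_iff₀ hpos]
    calc K * δ * (1 + t) ^ 8 ≤ K * (D * υ ^ 8) * (2 / (T' * υ)) ^ 8 := by gcongr
      _ = K * D * (υ ^ 8 * (2 / (T' * υ)) ^ 8) := by ring
      _ = K * D * (2 ^ 8 / T' ^ 8) := by rw [hpow]
      _ ≤ K * (W * T' ^ 8 / (2 ^ 10 * K)) * (2 ^ 8 / T' ^ 8) := by gcongr
      _ = W / 4 := by
          field_simp
          ring
  linarith

end Numerics

end Summit.QuantumFields.YangMills.Cruxes.IR.AfPincerUc

end
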